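import Summits.FinalStateConjecture.FinalStateConjecture.Theorems.ClusterCompletenessOmegaLimitMultiKerrEternalFamilies
import Literature.Geometry.Lorentzian.SpacetimeChartDeviationTransfer
import HarnessLib

/-!
# Route ClusterCompleteness · crux `OmegaLimitMultiKerr` — the `Cᵏ_loc` ω-limit set of the
# late-time translates is CLOSED, translation-INVARIANT and TRANSITIVE (Hale 1980, Thm. 8.1)

Structure lemmas for the crux stmt-FinalStateConjecture-14664
(`ClusterCompleteness.OmegaLimitMultiKerr`, rank 9), line `Sketch`, lead gen 5 (registered stub
`exists_omegaLimit_of_tendsto_omegaLimits`).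
Setting: a chart field `h : E → W` on an open domain `O ⊆ E` invariant under all translations
`x ↦ x + s • e` (the boosted Kerr exterior under its Killing time translation), its late-time
translates `x ↦ h (x + T n • e)`, and convergence measured in `Cᵏ_loc(O)`:
`supCkENorm K k (…) → 0` on every compact `K ⊆ O`. A field `g` is an **ω-limit of `h`** when
`∃ T → +∞, ∀ K ⊆ O compact, supCkENorm K k (h (· + T n • e) − g) → 0`.

* `exists_omegaLimit_of_tendsto_omegaLimits` (the registered stub) — **the ω-limit set is closed**
  (Hale 1980, Ch. I §8, Thm. 8.1): a `Cᵏ_loc` limit `g` of ω-limits `gs m` is an ω-limit. DIAGONAL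
  argument over the monotone compact exhaustion `m ↦ ⋃ i ≤ m, Kx i` (`Set.accumulate`): at stage `m`
  pick a time `τ m ≥ m` of the `m`-th family within `1/(m+1)` of `gs m` in `Cᵏ(⋃ i ≤ m, Kx i)`, then
  `‖h (· + τ m • e) − g‖ ≤ ‖h (· + τ m • e) − gs m‖ + ‖gs m − g‖` (`supCkENorm_add_le`) and squeeze.
* `exists_omegaLimit_translate` — **invariance**: every time-translate `g (· + s • e)` of an
  ω-limit is an ω-limit (along the shifted times `T n + s`;
  `tendsto_supCkENorm_translate_add_shift`).
* `exists_omegaLimit_of_omegaLimit_of_omegaLimit` — **transitivity** `ω(ω(h)) ⊆ ω(h)`: an ω-limit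
  of an ω-limit `g` of `h` is an ω-limit of `h` (closedness applied to the translates of `g`).
* `exists_isCompact_subset_nat_of_isOpen` — the exhaustion hypothesis `Kx` is always available: an
  open subset of a finite-dimensional space carries compact subsets `Kx j ⊆ O`, `j : ℕ`, swallowing
  every compact subset of `O` (`CompactExhaustion` of the locally compact σ-compact subspace `O`).

Everything is proved; Mathlib + `Literature` + the line's `supCkENorm` bookkeeping only.

References: J. K. Hale, *Ordinary Differential Equations*, 2nd ed. (Krieger 1980), Ch. I §8,
Theorem 8.1 (ω-limit sets are closed and invariant).
-/

-- every `Summit.FinalStateConjecture.FinalStateConjecture.…` name repeats the summit = sub-problem segment (D-0017 layout)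
set_option linter.dupNamespace false

noncomputable section

open Set Filter Topology Function
open scoped ContDiff Topology ENNReal

namespace Summit.FinalStateConjecture.FinalStateConjecture.Theorems.ClusterCompleteness

open Literature.Geometry.Lorentzian

/-- **Translates of a `Cᵏ` field are `Cᵏ`.** On a domain `O` invariant under all translations
`x ↦ x + s • e`, a field `h` which is `Cᵏ` on `O` has `Cᵏ` translates `x ↦ h (x + s • e)` on `O`
(chain rule with the affine translation, which maps `O` into `O`). [folklore] -/
theorem contDiffOn_comp_add_smul_of_forall_mem :
    ∀ {E : Type*} [NormedAddCommGroup E] [NormedSpace ℝ E]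
      {W : Type*} [NormedAddCommGroup W] [NormedSpace ℝ W] {O : Set E} {e : E},
      (∀ x ∈ O, ∀ s : ℝ, x + s • e ∈ O) →
      ∀ {k : ℕ} {h : E → W}, ContDiffOn ℝ k h O →
      ∀ s : ℝ, ContDiffOn ℝ k (fun x ↦ h (x + s • e)) O := by
  intro E _ _ W _ _ O e hOe k h hh s
  exact hh.comp (contDiffOn_id.add contDiffOn_const) fun x hx ↦ hOe x hx s

/-- **Translates of a `Cᵏ` field are `Cᵏ` at every point of the domain** (pointwise form of
`contDiffOn_comp_add_smul_of_forall_mem` on an OPEN invariant domain). [folklore] -/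
theorem contDiffAt_comp_add_smul_of_forall_mem :
    ∀ {E : Type*} [NormedAddCommGroup E] [NormedSpace ℝ E]
      {W : Type*} [NormedAddCommGroup W] [NormedSpace ℝ W] {O : Set E} {e : E},
      IsOpen O → (∀ x ∈ O, ∀ s : ℝ, x + s • e ∈ O) →
      ∀ {k : ℕ} {h : E → W}, ContDiffOn ℝ k h O →
      ∀ (s : ℝ), ∀ x ∈ O, ContDiffAt ℝ k (fun y ↦ h (y + s • e)) x := by
  intro E _ _ W _ _ O e hO hOe k h hh s x hx
  exact (contDiffOn_comp_add_smul_of_forall_mem hOe hh s).contDiffAt (hO.mem_nhds hx)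

/-- **The `Cᵏ_loc` ω-limit set of the late-time translates is closed** (Hale 1980, Ch. I §8,
Theorem 8.1, in the `Cᵏ_loc`-translate currency of the crux). Let `O` be open and invariant under
all translations `x ↦ x + s • e`, exhausted by compact sets `Kx j ⊆ O` swallowing every compact
subset of `O`; let `h`, `gs m`, `g` be `Cᵏ` on `O`. If every `gs m` is an ω-limit of `h`
(`∃ T → +∞`, `supCkENorm K k (h (· + T n • e) − gs m) → 0` on every compact `K ⊆ O`) and
`gs m → g` in `Cᵏ_loc(O)`, then `g` is an ω-limit of `h`. Proof: diagonal choice of times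
`τ m ≥ m` with `‖h (· + τ m • e) − gs m‖_{Cᵏ(⋃ i ≤ m, Kx i)} < 1/(m+1)`, subadditivity of the
`Cᵏ` sup norm and a squeeze. [cite: Hale1980, Ch. I §8 Thm. 8.1] -/
theorem exists_omegaLimit_of_tendsto_omegaLimits :
    ∀ {E : Type*} [NormedAddCommGroup E] [NormedSpace ℝ E]
      {W : Type*} [NormedAddCommGroup W] [NormedSpace ℝ W]
      {O : Set E} {e : E}, IsOpen O → (∀ x ∈ O, ∀ s : ℝ, x + s • e ∈ O) →
      ∀ (Kx : ℕ → Set E), (∀ j, IsCompact (Kx j)) → (∀ j, Kx j ⊆ O) →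
      (∀ K ⊆ O, IsCompact K → ∃ j, K ⊆ Kx j) →
      ∀ {k : ℕ} {h : E → W}, ContDiffOn ℝ k h O →
      ∀ {gs : ℕ → E → W}, (∀ m, ContDiffOn ℝ k (gs m) O) →
      (∀ m, ∃ T : ℕ → ℝ, Tendsto T atTop atTop ∧ ∀ K ⊆ O, IsCompact K →
        Tendsto (fun n ↦ supCkENorm K k (fun x ↦ h (x + T n • e) - gs m x)) atTop (𝓝 0)) →
      ∀ {g : E → W}, ContDiffOn ℝ k g O →
      (∀ K ⊆ O, IsCompact K →
        Tendsto (fun m ↦ supCkENorm K k (fun x ↦ gs m x - g x)) atTop (𝓝 0)) →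
      ∃ T : ℕ → ℝ, Tendsto T atTop atTop ∧ ∀ K ⊆ O, IsCompact K →
        Tendsto (fun n ↦ supCkENorm K k (fun x ↦ h (x + T n • e) - g x)) atTop (𝓝 0) := by
  intro E _ _ W _ _ O e hO hOe Kx hKc hKO hcov k h hh gs hgs hω g hg hlim
  -- the monotone compact exhaustion `m ↦ ⋃ i ≤ m, Kx i` of `O`
  have hAO : ∀ m, accumulate Kx m ⊆ O := fun m ↦
    (accumulate_subset_iUnion m).trans (iUnion_subset hKO)
  -- diagonal choice: at stage `m`, a time `τ ≥ m` of the `m`-th family at which the translate is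
  -- within `1/(m+1)` of `gs m` in `Cᵏ(⋃ i ≤ m, Kx i)`
  have key : ∀ m : ℕ, ∃ τ : ℝ, (m : ℝ) ≤ τ ∧
      supCkENorm (accumulate Kx m) k (fun x ↦ h (x + τ • e) - gs m x) <
        ((m + 1 : ℕ) : ℝ≥0∞)⁻¹ := by
    intro m
    obtain ⟨T, hT, hTlim⟩ := hω m
    obtain ⟨n, hn, hn'⟩ := ((hT.eventually_ge_atTop (m : ℝ)).and
      ((hTlim _ (hAO m) (isCompact_accumulate hKc m)).eventually
        (gt_mem_nhds (ENNReal.inv_pos.2 (ENNReal.natCast_ne_top (m + 1)))))).exists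
    exact ⟨T n, hn, hn'⟩
  choose τ hτ hτlt using key
  refine ⟨τ, tendsto_atTop_mono hτ tendsto_natCast_atTop_atTop, fun K hKO' hK ↦ ?_⟩
  obtain ⟨j, hj⟩ := hcov K hKO' hK
  -- the vanishing majorant `1/(m+1) + ‖gs m − g‖_{Cᵏ(K)}`
  have hmaj : Tendsto (fun m : ℕ ↦ ((m + 1 : ℕ) : ℝ≥0∞)⁻¹ +
      supCkENorm K k (fun x ↦ gs m x - g x)) atTop (𝓝 0) := by
    have h1 : Tendsto (fun m : ℕ ↦ ((m + 1 : ℕ) : ℝ≥0∞)⁻¹) atTop (𝓝 0) :=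
      ENNReal.tendsto_inv_nat_nhds_zero.comp (tendsto_add_atTop_nat 1)
    simpa only [add_zero] using h1.add (hlim K hKO' hK)
  refine tendsto_of_tendsto_of_tendsto_of_le_of_le' tendsto_const_nhds hmaj
    (Eventually.of_forall fun _ ↦ zero_le) ?_
  filter_upwards [eventually_ge_atTop j] with m hm
  have hKm : K ⊆ accumulate Kx m :=
    hj.trans (subset_accumulate.trans (monotone_accumulate hm))
  -- `h (· + τ m • e) − g = (h (· + τ m • e) − gs m) + (gs m − g)`, both summands `Cᵏ` on `K ⊆ O`
  have hsplit : (fun x ↦ h (x + τ m • e) - g x) =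
      (fun x ↦ h (x + τ m • e) - gs m x) + fun x ↦ gs m x - g x := by
    funext x
    simp only [Pi.add_apply, sub_add_sub_cancel]
  have h1 : ∀ x ∈ K, ContDiffAt ℝ k (fun x ↦ h (x + τ m • e) - gs m x) x := fun x hx ↦
    (contDiffAt_comp_add_smul_of_forall_mem hO hOe hh (τ m) x (hKO' hx)).sub
      ((hgs m).contDiffAt (hO.mem_nhds (hKO' hx)))
  have h2 : ∀ x ∈ K, ContDiffAt ℝ k (fun x ↦ gs m x - g x) x := fun x hx ↦
    ((hgs m).contDiffAt (hO.mem_nhds (hKO' hx))).sub (hg.contDiffAt (hO.mem_nhds (hKO' hx)))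
  rw [hsplit]
  refine (supCkENorm_add_le h1 h2).trans (add_le_add ?_ le_rfl)
  exact (supCkENorm_mono hKm k _).trans (hτlt m).le

/-- **The ω-limit set is translation-invariant** (Hale 1980, Ch. I §8, Theorem 8.1: ω-limit sets
are invariant). On a domain `O` invariant under all translations `x ↦ x + s • e`: if `g` is the
`Cᵏ_loc` ω-limit of `h` along times `T n → +∞`, then every translate `x ↦ g (x + s • e)`,
`s ∈ ℝ`, is an ω-limit of `h` (along the times `T n + s`). [cite: Hale1980, Ch. I §8 Thm. 8.1] -/
theorem exists_omegaLimit_translate :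
    ∀ {E : Type*} [NormedAddCommGroup E] [NormedSpace ℝ E]
      {W : Type*} [NormedAddCommGroup W] [NormedSpace ℝ W] {O : Set E} {e : E},
      (∀ x ∈ O, ∀ s : ℝ, x + s • e ∈ O) →
      ∀ {k : ℕ} {h g : E → W} {T : ℕ → ℝ}, Tendsto T atTop atTop →
      (∀ K ⊆ O, IsCompact K →
        Tendsto (fun n ↦ supCkENorm K k (fun x ↦ h (x + T n • e) - g x)) atTop (𝓝 0)) →
      ∀ s : ℝ, ∃ T' : ℕ → ℝ, Tendsto T' atTop atTop ∧ ∀ K ⊆ O, IsCompact K →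
        Tendsto (fun n ↦ supCkENorm K k (fun x ↦ h (x + T' n • e) - g (x + s • e)))
          atTop (𝓝 0) := by
  intro E _ _ W _ _ O e hOe k h g T hT hlim s
  exact ⟨fun n ↦ T n + s, tendsto_atTop_add_const_right _ s hT,
    tendsto_supCkENorm_translate_add_shift hOe hlim s⟩

/-- **Transitivity of ω-limits: `ω(ω(h)) ⊆ ω(h)`** (Hale 1980, Ch. I §8, Theorem 8.1, closedness
combined with invariance). In the setting of `exists_omegaLimit_of_tendsto_omegaLimits`: if the
`Cᵏ` field `g` is an ω-limit of `h` and the `Cᵏ` field `g'` is an ω-limit of `g`, then `g'` is an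
ω-limit of `h` — the translates `g (· + S m • e)` are ω-limits of `h`
(`exists_omegaLimit_translate`) converging to `g'` in `Cᵏ_loc(O)`.
[cite: Hale1980, Ch. I §8 Thm. 8.1] -/
theorem exists_omegaLimit_of_omegaLimit_of_omegaLimit :
    ∀ {E : Type*} [NormedAddCommGroup E] [NormedSpace ℝ E]
      {W : Type*} [NormedAddCommGroup W] [NormedSpace ℝ W]
      {O : Set E} {e : E}, IsOpen O → (∀ x ∈ O, ∀ s : ℝ, x + s • e ∈ O) →
      ∀ (Kx : ℕ → Set E), (∀ j, IsCompact (Kx j)) → (∀ j, Kx j ⊆ O) →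
      (∀ K ⊆ O, IsCompact K → ∃ j, K ⊆ Kx j) →
      ∀ {k : ℕ} {h : E → W}, ContDiffOn ℝ k h O →
      ∀ {g : E → W}, ContDiffOn ℝ k g O →
      (∃ T : ℕ → ℝ, Tendsto T atTop atTop ∧ ∀ K ⊆ O, IsCompact K →
        Tendsto (fun n ↦ supCkENorm K k (fun x ↦ h (x + T n • e) - g x)) atTop (𝓝 0)) →
      ∀ {g' : E → W}, ContDiffOn ℝ k g' O →
      (∃ S : ℕ → ℝ, Tendsto S atTop atTop ∧ ∀ K ⊆ O, IsCompact K →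
        Tendsto (fun m ↦ supCkENorm K k (fun x ↦ g (x + S m • e) - g' x)) atTop (𝓝 0)) →
      ∃ T : ℕ → ℝ, Tendsto T atTop atTop ∧ ∀ K ⊆ O, IsCompact K →
        Tendsto (fun n ↦ supCkENorm K k (fun x ↦ h (x + T n • e) - g' x)) atTop (𝓝 0) := by
  intro E _ _ W _ _ O e hO hOe Kx hKc hKO hcov k h hh g hg hωg g' hg' hωg'
  obtain ⟨T, hT, hlim⟩ := hωg
  obtain ⟨S, -, hlim'⟩ := hωg'
  exact exists_omegaLimit_of_tendsto_omegaLimits hO hOe Kx hKc hKO hcov hh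
    (gs := fun m x ↦ g (x + S m • e)) (fun m ↦ contDiffOn_comp_add_smul_of_forall_mem hOe hg (S m))
    (fun m ↦ exists_omegaLimit_translate hOe hT hlim (S m)) hg' hlim'

/-- **Compact exhaustions exist.** An open subset `O` of a finite-dimensional real normed space
carries compact subsets `Kx j ⊆ O`, `j : ℕ`, such that every compact `K ⊆ O` lies in some `Kx j`
(the subspace `O` is locally compact and σ-compact, so it has a `CompactExhaustion`, whose members
eventually swallow every compact set) — the exhaustion hypothesis of
`exists_omegaLimit_of_tendsto_omegaLimits`. [folklore] -/
theorem exists_isCompact_subset_nat_of_isOpen :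
    ∀ {E : Type*} [NormedAddCommGroup E] [NormedSpace ℝ E] [FiniteDimensional ℝ E]
      {O : Set E}, IsOpen O → ∃ Kx : ℕ → Set E,
      (∀ j, IsCompact (Kx j)) ∧ (∀ j, Kx j ⊆ O) ∧ ∀ K ⊆ O, IsCompact K → ∃ j, K ⊆ Kx j := by
  intro E _ _ _ O hO
  haveI : LocallyCompactSpace O := hO.locallyCompactSpace
  set K' : CompactExhaustion O := CompactExhaustion.choice O
  refine ⟨fun j ↦ Subtype.val '' K' j, fun j ↦ (K'.isCompact j).image continuous_subtype_val,
    fun j ↦ Subtype.coe_image_subset O (K' j), fun K hKO hK ↦ ?_⟩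
  have hK' : IsCompact (Subtype.val ⁻¹' K : Set O) :=
    IsInducing.subtypeVal.isCompact_preimage' hK (by rwa [Subtype.range_val])
  obtain ⟨n, hn⟩ := K'.exists_superset_of_isCompact hK'
  exact ⟨n, fun x hx ↦ ⟨⟨x, hKO hx⟩, hn (show (⟨x, hKO hx⟩ : O) ∈ Subtype.val ⁻¹' K from hx), rfl⟩⟩

end Summit.FinalStateConjecture.FinalStateConjecture.Theorems.ClusterCompleteness

end
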